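/-
Copyright (c) 2026 the pub-hodgecm-mathlib formalisation cell (harness21).  Prover seat hodgecm-mathlib-F0P2-p06 (g10), 2026-09-01.  Road «S3-tree» (architect A-p16 (g30) A-88 (8)),
brick T3′ «depth-zero κ-transfer», population (P-2) TYPE (2), row (R0²): organ FILE γ₁ «THE TYPE-(2) MÖBIUS DICTIONARY OVER ONE VALUED FIELD» — the exponent, regularity,
irreducibility and integrality bookkeeping of the Cayley∕Möbius shift of a deep type-(2) pair `(g, u)`, read on `tr`, `det`, `χ_g(u)` only (no eigenvalue, no splitting field).
-/
import Literature.NumberTheory.Automorphic.MatrixMoebiusShift            -- ★ FILE α p846376 (this seat): `disc_moebius_fin_two`, `eval_charpoly_moebius_fin_two`, `forall_mem_*`, `det_mul_inv_eq_div`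
import Literature.NumberTheory.Automorphic.ResiduallySkewShiftUnits       -- ★ FILE β p846386 (F0P3a-p07 (g11)): `valued_det_two_smul_one_add_smul_eq_one`, `valued_two_add_mul_eq_one`, skewness from unitarity
import Literature.NumberTheory.Rogawski1990.WeylVanishingSplitNonRegularNull    -- ★ `charpoly_separable_of_trace_sq_sub_four_mul_det_ne_zero` (2 × 2 separability from the discriminant), cited BY NAME (dedup)
import Mathlib.Algebra.QuadraticDiscriminant
import Mathlib.FieldTheory.Separable
import HarnessLib

/-!
# The type-(2) Möbius dictionary over a valued field: `(n, N) ↦ (n − 2, N − 1)`, regularity, irreducibility, integrality — eigenvalue-free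

Topic `NumberTheory/Automorphic`; namespace `Literature.NumberTheory.Automorphic.MoebiusShift`.  THEOREMS ONLY (no definition, no instance, no notation, no named fact, no
`sorry`); generic `[Field K] [Valued K ℤᵐ⁰]` with an isometric ring endomorphism `σ` fixing the shift parameter `c` (`|c| = exp(−1)`), `|2| = 1`.  Cell `pub/hodgecm-mathlib`,
crux H413 = `stmt-HodgeConjecture-24833`; road «S3-tree», brick T3′ «depth-zero κ-transfer», row (R0²) of the ★ type-(2) socket p846003 (census
`F0/P2/F0P2-p06/g10/CENSUS-T3prime-P2-assembly.F0P2p06g10.md` §3 (b)(d)).  HONEST LABEL: HC_CM is proved only modulo the cell's 2 remaining named inputs (hLiu418, h413) until rung 0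
closes; valuation bookkeeping, asserts nothing printed.

THE MATHEMATICS.  A deep type-(2) endoscopic element at a non-split unramified place is a pair `(g, u)`: `g ∈ U(σ, J₂)(K)`, `J₂ = antidiag(1,1)`, `2 × 2` with `χ_g` IRREDUCIBLE over
`K = L_w`, `|disc χ_g| = exp(−(2N+1))`, and `u ∈ K` with `σ(u)u = 1`, `|χ_g(u)| = exp(−n)`; «deep in `V`» means `g ≡ 1`, `u ≡ 1 (mod c)`: `g = 1 + cX₂`, `u = 1 + cy` with `X₂`, `y`
integral.  The Möbius shift `φ(t) = ((c+1)t + (c−1))((c−1)t + (c+1))⁻¹` (★ FILE α) has denominators `(c−1)g + (c+1) = c·(2 + (c−1)X₂)` and `(c−1)u + (c+1) = c·(2 + (c−1)y)`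
whose cofactors `det(2 + (c−1)X₂)`, `2 + (c−1)y` are UNITS by ★ FILE β (the trace of `X₂` and `y` are residually skew by unitarity, `χ̄_{X₂}` is a square since `|disc χ_{X₂}| =
|disc χ_g|∕|c|² < 1` for `N ≥ 1`).  Hence (§2) `|det((c−1)g+(c+1))| = exp(−2)`, `|(c−1)u+(c+1)| = exp(−1)`, and ★ FILE α's two `2 × 2` identities give (§3) THE DICTIONARY
`|disc χ_{φg}| = exp(−(2(N−1)+1))`, `|χ_{φg}(φu)| = exp(−(n−2))`; (§4) `χ_{φg}` has no root in `K` if `χ_g` has none (the discriminants differ by the square `(4c∕det D)²`;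
Mathlib `quadratic_eq_zero_iff_discrim_eq_sq` ∕ `exists_quadratic_eq_zero`), and `χ_{φg}·(X − φu)` is separable (explicit Bézout for the quadratic, coprimality with the linear
factor from `χ_{φg}(φu) ≠ 0`; the quadratic's separability is ★ `charpoly_separable_of_trace_sq_sub_four_mul_det_ne_zero`); (§5) `φg = N₊N₋⁻¹` and `φu` are integral.

## References
* [Rogawski1990] J. D. Rogawski, *Automorphic Representations of Unitary Groups in Three Variables* (1990), §4.9 Prop. 4.9.1 (b) p. 55; §3.5–3.6.
* [Kottwitz1986] R. E. Kottwitz, *Base change for unit elements of Hecke algebras*, Compositio Math. 60 (1986), §3.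
* [Flicker1998UnitaryFL] Y. Z. Flicker, *Elementary proof of the fundamental lemma for a unitary group*, Canad. J. Math. 50 (1998), §6 (the type-(2) exponents `n`, `2N+1`).
* [SerreLocalFields1979] J.-P. Serre, *Local Fields* (1979), Ch. I §§1–2.
-/

set_option autoImplicit false

open Matrix Polynomial
open scoped Valued WithZero

namespace Literature.NumberTheory.Automorphic.MoebiusShift

variable {K : Type*} [Field K] [Valued K ℤᵐ⁰]

/-! ## §1 The deep frame: `X₂ = c⁻¹(g − 1)`, `y = c⁻¹(u − 1)` are integral, their traces residually skew, `χ̄_{X₂}` a square -/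

/-- `|c| = exp(−1)` ⇒ `c ≠ 0`, `|c| < 1`, `|c − 1| = 1 = |c + 1|`, `|(c−1) + 1| < 1`, `|(c+1) − 1| < 1`. [cite: SerreLocalFields1979, Ch. I §§1–2] -/
theorem shift_parameter_facts {c : K} (hc : Valued.v c = WithZero.exp (-1 : ℤ)) :
    c ≠ 0 ∧ Valued.v c < 1 ∧ Valued.v (c - 1) = 1 ∧ Valued.v (c + 1) = 1 ∧ Valued.v (c - 1 + 1) < 1 ∧ Valued.v (c + 1 - 1) < 1 := by
  have hc1 : Valued.v c < 1 := by rw [hc, ← WithZero.exp_zero, WithZero.exp_lt_exp]; norm_num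
  have hc0 : c ≠ 0 := fun h => by rw [h, map_zero] at hc; exact WithZero.zero_ne_coe hc
  have h1 : Valued.v c < Valued.v (1 : K) := by rwa [map_one]
  have hn1 : Valued.v c < Valued.v (-1 : K) := by rwa [Valuation.map_neg, map_one]
  refine ⟨hc0, hc1, ?_, ?_, by rwa [sub_add_cancel], by rwa [add_sub_cancel_right]⟩
  · rw [sub_eq_add_neg, Valuation.map_add_eq_of_lt_right _ hn1, Valuation.map_neg, map_one]
  · rw [Valuation.map_add_eq_of_lt_right _ h1, map_one]

/-- **Integrality of the shifted coordinate**: `|c⁻¹(x − 1)| ≤ 1` when `|x − 1| ≤ |c|`, `c ≠ 0`. [cite: SerreLocalFields1979, Ch. I §§1–2] -/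
theorem valued_inv_mul_sub_one_le_one {c x : K} (hc0 : c ≠ 0) (hx : Valued.v (x - 1) ≤ Valued.v c) : Valued.v (c⁻¹ * (x - 1)) ≤ 1 := by
  rw [map_mul, map_inv₀]
  have hvc : Valued.v c ≠ 0 := (Valuation.ne_zero_iff _).2 hc0
  calc (Valued.v c)⁻¹ * Valued.v (x - 1) ≤ (Valued.v c)⁻¹ * Valued.v c := by gcongr
    _ = 1 := inv_mul_cancel₀ hvc

/-- Entrywise: `X₂ := c⁻¹(g − 1)` is integral when `g ≡ 1 (mod c)` entrywise. [cite: SerreLocalFields1979, Ch. I §§1–2] -/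
theorem forall_valued_inv_smul_sub_one_le_one {m : Type*} [DecidableEq m] {c : K} (hc0 : c ≠ 0) {g : Matrix m m K}
    (hg1 : ∀ i j, Valued.v ((g - 1) i j) ≤ Valued.v c) : ∀ i j, Valued.v ((c⁻¹ • (g - 1)) i j) ≤ 1 := fun i j => by
  rw [Matrix.smul_apply, smul_eq_mul]
  exact valued_inv_mul_sub_one_le_one (x := (g - 1) i j + 1) hc0 (by rw [add_sub_cancel_right]; exact hg1 i j) |>.trans_eq' (by rw [add_sub_cancel_right])

omit [Valued K ℤᵐ⁰] in
/-- `g = 1 + c • (c⁻¹ • (g − 1))` (`c ≠ 0`). [cite: Kottwitz1986, §3] -/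
theorem eq_one_add_smul_inv_smul_sub_one {m : Type*} [DecidableEq m] {c : K} (hc0 : c ≠ 0) (g : Matrix m m K) :
    g = 1 + c • (c⁻¹ • (g - 1)) := by
  rw [smul_smul, mul_inv_cancel₀ hc0, one_smul, add_sub_cancel]

omit [Valued K ℤᵐ⁰] in
/-- The two Möbius sides of `g = 1 + cX`: `(c+1)g + (c−1) = c·(2 + (c+1)X)`, `(c−1)g + (c+1) = c·(2 + (c−1)X)`. [cite: Kottwitz1986, §3] -/
theorem smul_one_add_smul_add_smul_one {m : Type*} [DecidableEq m] [Fintype m] (X : Matrix m m K) (c a b : K) (hab : a + b = 2 * c) :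
    a • ((1 : Matrix m m K) + c • X) + b • (1 : Matrix m m K) = c • ((2 : K) • (1 : Matrix m m K) + a • X) := by
  rw [smul_add, smul_add, smul_smul, smul_smul, smul_smul, mul_comm c a]
  have : a • (1 : Matrix m m K) + b • (1 : Matrix m m K) = (c * 2) • (1 : Matrix m m K) := by rw [← add_smul, hab, mul_comm]
  rw [add_right_comm, this]

/-- **The trace of `X₂` is residually skew and `χ̄_{X₂}` is a square** — for `g = 1 + cX₂ ∈ U(σ, antidiag(1,1))`, `|disc χ_g| = exp(−(2N+1))`, `N ≥ 1`, `|c| = exp(−1)`: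
`|σ(tr X₂) + tr X₂| < 1` (★ FILE β) and `|tr X₂² − 4 det X₂| < 1`. [cite: Rogawski1990, §3.5–3.6] [cite: Kottwitz1986, §3] -/
theorem skew_and_square_of_unitary_two (σ : K →+* K) (hσ : ∀ x, Valued.v (σ x) = Valued.v x) {c : K} (hc : Valued.v c = WithZero.exp (-1 : ℤ)) (hσc : σ c = c)
    {X : Matrix (Fin 2) (Fin 2) K} (hX : ∀ i j, Valued.v (X i j) ≤ 1)
    (hg : ((((1 : Matrix (Fin 2) (Fin 2) K) + c • X).map σ)ᵀ * !![(0 : K), 1; 1, 0] * ((1 : Matrix (Fin 2) (Fin 2) K) + c • X)) = !![(0 : K), 1; 1, 0])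
    {N : ℕ} (hN1 : 1 ≤ N)
    (hN : Valued.v (((1 : Matrix (Fin 2) (Fin 2) K) + c • X).trace ^ 2 - 4 * ((1 : Matrix (Fin 2) (Fin 2) K) + c • X).det) = WithZero.exp (-((2 * N + 1 : ℕ) : ℤ))) :
    Valued.v (σ X.trace + X.trace) < 1 ∧ Valued.v (X.trace ^ 2 - 4 * X.det) < 1 := by
  obtain ⟨hc0, hc1, -, -, -, -⟩ := shift_parameter_facts hc
  refine ⟨valued_map_trace_add_trace_lt_one_of_unitary σ hσ (J := !![(0 : K), 1; 1, 0]) (fun i j => ?_) ?_ hc0 hc1 hσc hX hg, ?_⟩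
  · fin_cases i <;> fin_cases j <;> simp
  · simp [Matrix.det_fin_two]
  · rw [trace_sq_sub_four_det_one_add_smul, map_mul, map_pow, hc, ← WithZero.exp_nsmul] at hN
    have hvc : WithZero.exp ((2 : ℕ) • (-1 : ℤ)) ≠ 0 := WithZero.exp_ne_zero
    have h : Valued.v (X.trace ^ 2 - 4 * X.det) = (WithZero.exp ((2 : ℕ) • (-1 : ℤ)))⁻¹ * WithZero.exp (-((2 * N + 1 : ℕ) : ℤ)) := by
      rw [eq_inv_mul_iff_mul_eq₀ hvc]; exact hN
    rw [← WithZero.exp_neg, ← WithZero.exp_add] at h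
    rw [h, ← WithZero.exp_zero, WithZero.exp_lt_exp]
    simp only [smul_neg, nsmul_eq_mul, Nat.cast_ofNat, mul_one, neg_neg]
    omega

/-! ## §2 The Möbius denominators: `|det((c∓1)g + (c±1))| = exp(−2)`, `|(c∓1)u + (c±1)| = exp(−1)` -/

/-- **The cofactor units** `|det(2 + (c±1)X₂)| = 1` (★ FILE β at `t = c ± 1 ≡ ±1`). [cite: Kottwitz1986, §3] [cite: SerreLocalFields1979, Ch. I §§1–2] -/
theorem valued_det_two_smul_one_add_shift_smul_eq_one (σ : K →+* K) (hσ : ∀ x, Valued.v (σ x) = Valued.v x) (h2 : Valued.v (2 : K) = 1)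
    {c : K} (hc : Valued.v c = WithZero.exp (-1 : ℤ)) {X : Matrix (Fin 2) (Fin 2) K} (hX : ∀ i j, Valued.v (X i j) ≤ 1)
    (hskew : Valued.v (σ X.trace + X.trace) < 1) (hdisc : Valued.v (X.trace ^ 2 - 4 * X.det) < 1) :
    Valued.v (((2 : K) • (1 : Matrix (Fin 2) (Fin 2) K) + (c - 1) • X).det) = 1 ∧ Valued.v (((2 : K) • (1 : Matrix (Fin 2) (Fin 2) K) + (c + 1) • X).det) = 1 := by
  obtain ⟨-, -, hm, hp, hm1, hp1⟩ := shift_parameter_facts hc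
  exact ⟨valued_det_two_smul_one_add_smul_eq_one σ hσ h2 hX hdisc hskew hm.le (Or.inr hm1),
    valued_det_two_smul_one_add_smul_eq_one σ hσ h2 hX hdisc hskew hp.le (Or.inl hp1)⟩

/-- **The scalar cofactor units** `|2 + (c±1)y| = 1` for `y` residually skew. [cite: SerreLocalFields1979, Ch. I §§1–2] -/
theorem valued_two_add_shift_mul_eq_one (σ : K →+* K) (hσ : ∀ x, Valued.v (σ x) = Valued.v x) (h2 : Valued.v (2 : K) = 1)
    {c : K} (hc : Valued.v c = WithZero.exp (-1 : ℤ)) {y : K} (hy : Valued.v y ≤ 1) (hskew : Valued.v (σ y + y) < 1) :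
    Valued.v (2 + y * (c - 1)) = 1 ∧ Valued.v (2 + y * (c + 1)) = 1 := by
  obtain ⟨-, -, hm, hp, hm1, hp1⟩ := shift_parameter_facts hc
  exact ⟨valued_two_add_mul_eq_one σ hσ h2 hy hm.le hskew (Or.inr hm1), valued_two_add_mul_eq_one σ hσ h2 hy hp.le hskew (Or.inl hp1)⟩

/-- **The matrix denominators**: `|det((c−1)g + (c+1))| = exp(−2) = |det((c+1)g + (c−1))|` for `g = 1 + cX₂` with the cofactors units. [cite: Kottwitz1986, §3] -/
theorem valued_det_shift_denominators {c : K} (hc : Valued.v c = WithZero.exp (-1 : ℤ)) {X : Matrix (Fin 2) (Fin 2) K}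
    (hm : Valued.v (((2 : K) • (1 : Matrix (Fin 2) (Fin 2) K) + (c - 1) • X).det) = 1) (hp : Valued.v (((2 : K) • (1 : Matrix (Fin 2) (Fin 2) K) + (c + 1) • X).det) = 1) :
    Valued.v (((c - 1) • ((1 : Matrix (Fin 2) (Fin 2) K) + c • X) + (c + 1) • (1 : Matrix (Fin 2) (Fin 2) K)).det) = WithZero.exp (-2 : ℤ) ∧
      Valued.v (((c + 1) • ((1 : Matrix (Fin 2) (Fin 2) K) + c • X) + (c - 1) • (1 : Matrix (Fin 2) (Fin 2) K)).det) = WithZero.exp (-2 : ℤ) := by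
  have e2 : WithZero.exp (-2 : ℤ) = WithZero.exp (-1 : ℤ) ^ 2 * 1 := by rw [mul_one, ← WithZero.exp_nsmul]; norm_num
  constructor
  · rw [smul_one_add_smul_add_smul_one X c (c - 1) (c + 1) (by ring), Matrix.det_smul, Fintype.card_fin, map_mul, map_pow, hc, hm, e2]
  · rw [smul_one_add_smul_add_smul_one X c (c + 1) (c - 1) (by ring), Matrix.det_smul, Fintype.card_fin, map_mul, map_pow, hc, hp, e2]

/-- **The scalar denominators**: `|(c−1)u + (c+1)| = exp(−1) = |(c+1)u + (c−1)|` for `u = 1 + cy` with the cofactors units. [cite: Kottwitz1986, §3] -/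
theorem valued_shift_denominators_one {c : K} (hc : Valued.v c = WithZero.exp (-1 : ℤ)) {y : K}
    (hm : Valued.v (2 + y * (c - 1)) = 1) (hp : Valued.v (2 + y * (c + 1)) = 1) :
    Valued.v ((c - 1) * (1 + c * y) + (c + 1)) = WithZero.exp (-1 : ℤ) ∧ Valued.v ((c + 1) * (1 + c * y) + (c - 1)) = WithZero.exp (-1 : ℤ) := by
  constructor
  · rw [show (c - 1) * (1 + c * y) + (c + 1) = c * (2 + y * (c - 1)) by ring, map_mul, hc, hm, mul_one]
  · rw [show (c + 1) * (1 + c * y) + (c - 1) = c * (2 + y * (c + 1)) by ring, map_mul, hc, hp, mul_one]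

/-! ## §3 THE DICTIONARY `(n, N) ↦ (n − 2, N − 1)` -/

/-- `|4c|² = exp(−2)` and `|(a² − b²)|² = exp(−2)` for `a = c+1`, `b = c−1` (`a² − b² = 4c`), `|2| = 1`. [cite: Kottwitz1986, §3] -/
theorem valued_sq_sub_sq_sq (h2 : Valued.v (2 : K) = 1) {c : K} (hc : Valued.v c = WithZero.exp (-1 : ℤ)) :
    Valued.v (((c + 1) ^ 2 - (c - 1) ^ 2) ^ 2) = WithZero.exp (-2 : ℤ) := by
  rw [show ((c + 1) ^ 2 - (c - 1) ^ 2) = 2 * 2 * c by ring, map_pow, map_mul, map_mul, h2, hc, one_mul, one_mul, ← WithZero.exp_nsmul]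
  norm_num

/-- **`N ↦ N − 1`**: `|disc χ_{φg}| = exp(−(2(N−1)+1))` when `|disc χ_g| = exp(−(2N+1))`, `|det((c−1)g+(c+1))| = exp(−2)`, `N ≥ 1` (★ FILE α `disc_moebius_fin_two`).
[cite: Flicker1998UnitaryFL, §6] [cite: Kottwitz1986, §3] -/
theorem valued_disc_moebius (h2 : Valued.v (2 : K) = 1) {c : K} (hc : Valued.v c = WithZero.exp (-1 : ℤ)) (g : Matrix (Fin 2) (Fin 2) K)
    (hD : Valued.v (((c - 1) • g + (c + 1) • (1 : Matrix (Fin 2) (Fin 2) K)).det) = WithZero.exp (-2 : ℤ)) {N : ℕ} (hN1 : 1 ≤ N)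
    (hN : Valued.v (g.trace ^ 2 - 4 * g.det) = WithZero.exp (-((2 * N + 1 : ℕ) : ℤ))) :
    Valued.v ((((c + 1) • g + (c - 1) • (1 : Matrix (Fin 2) (Fin 2) K)) * ((c - 1) • g + (c + 1) • (1 : Matrix (Fin 2) (Fin 2) K))⁻¹).trace ^ 2 -
        4 * (((c + 1) • g + (c - 1) • (1 : Matrix (Fin 2) (Fin 2) K)) * ((c - 1) • g + (c + 1) • (1 : Matrix (Fin 2) (Fin 2) K))⁻¹).det) =
      WithZero.exp (-((2 * (N - 1) + 1 : ℕ) : ℤ)) := by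
  have hD0 : ((c - 1) • g + (c + 1) • (1 : Matrix (Fin 2) (Fin 2) K)).det ≠ 0 := fun h => by
    rw [h, map_zero] at hD; exact WithZero.zero_ne_coe hD
  have key := congrArg Valued.v (disc_moebius_fin_two g (c + 1) (c - 1) hD0)
  rw [map_mul, map_mul, map_pow, hD, valued_sq_sub_sq_sq h2 hc, hN, ← WithZero.exp_nsmul, ← WithZero.exp_add] at key
  have hne : WithZero.exp ((2 : ℕ) • (-2 : ℤ)) ≠ 0 := WithZero.exp_ne_zero
  rw [← eq_mul_inv_iff_mul_eq₀ hne, ← WithZero.exp_neg, ← WithZero.exp_add] at key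
  rw [key, WithZero.exp_inj]
  simp only [smul_neg, nsmul_eq_mul, Nat.cast_ofNat]
  omega

/-- **`n ↦ n − 2`**: `|χ_{φg}(φu)| = exp(−(n−2))` when `|χ_g(u)| = exp(−n)`, `|det((c−1)g+(c+1))| = exp(−2)`, `|(c−1)u+(c+1)| = exp(−1)`, `n ≥ 2` (★ FILE α
`eval_charpoly_moebius_fin_two`). [cite: Flicker1998UnitaryFL, §6] [cite: Kottwitz1986, §3] -/
theorem valued_eval_charpoly_moebius (h2 : Valued.v (2 : K) = 1) {c : K} (hc : Valued.v c = WithZero.exp (-1 : ℤ)) (g : Matrix (Fin 2) (Fin 2) K) (u : K)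
    (hD : Valued.v (((c - 1) • g + (c + 1) • (1 : Matrix (Fin 2) (Fin 2) K)).det) = WithZero.exp (-2 : ℤ))
    (hu : Valued.v ((c - 1) * u + (c + 1)) = WithZero.exp (-1 : ℤ)) {n : ℕ} (hn2 : 2 ≤ n)
    (hn : Valued.v (g.charpoly.eval u) = WithZero.exp (-(n : ℤ))) :
    Valued.v ((((c + 1) • g + (c - 1) • (1 : Matrix (Fin 2) (Fin 2) K)) * ((c - 1) • g + (c + 1) • (1 : Matrix (Fin 2) (Fin 2) K))⁻¹).charpoly.eval
        (((c + 1) * u + (c - 1)) / ((c - 1) * u + (c + 1)))) = WithZero.exp (-((n - 2 : ℕ) : ℤ)) := by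
  have hD0 : ((c - 1) • g + (c + 1) • (1 : Matrix (Fin 2) (Fin 2) K)).det ≠ 0 := fun h => by
    rw [h, map_zero] at hD; exact WithZero.zero_ne_coe hD
  have hu0 : (c - 1) * u + (c + 1) ≠ 0 := fun h => by rw [h, map_zero] at hu; exact WithZero.zero_ne_coe hu
  have key := congrArg Valued.v (eval_charpoly_moebius_fin_two g (c + 1) (c - 1) u hD0 hu0)
  rw [map_mul, map_mul, map_mul, map_pow, hD, hu, valued_sq_sub_sq_sq h2 hc, hn, ← WithZero.exp_nsmul, mul_assoc, ← WithZero.exp_add, ← WithZero.exp_add] at key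
  have hne : WithZero.exp ((2 : ℕ) • (-1 : ℤ) + -2) ≠ 0 := WithZero.exp_ne_zero
  rw [← eq_mul_inv_iff_mul_eq₀ hne, ← WithZero.exp_neg, ← WithZero.exp_add] at key
  rw [key, WithZero.exp_inj]
  simp only [smul_neg, nsmul_eq_mul, Nat.cast_ofNat]
  omega

/-! ## §4 Irreducibility and separability of the shifted characteristic polynomial -/

omit [Valued K ℤᵐ⁰] in
/-- A `2 × 2` characteristic polynomial has a root iff its discriminant `tr² − 4 det` is a square (`2 ≠ 0`). [cite: SerreLocalFields1979, Ch. I §§1–2] -/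
theorem exists_isRoot_charpoly_iff_isSquare_disc [NeZero (2 : K)] (g : Matrix (Fin 2) (Fin 2) K) :
    (∃ x : K, g.charpoly.IsRoot x) ↔ ∃ s : K, g.trace ^ 2 - 4 * g.det = s * s := by
  have hform : ∀ x : K, g.charpoly.IsRoot x ↔ 1 * (x * x) + (-g.trace) * x + g.det = 0 := fun x => by
    rw [Polynomial.IsRoot, Matrix.charpoly_fin_two]
    simp only [eval_add, eval_sub, eval_mul, eval_pow, eval_C, eval_X]
    constructor <;> intro h <;> linear_combination h
  have hdisc : discrim (1 : K) (-g.trace) g.det = g.trace ^ 2 - 4 * g.det := by rw [discrim]; ring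
  constructor
  · rintro ⟨x, hx⟩
    rw [hform, quadratic_eq_zero_iff_discrim_eq_sq one_ne_zero, hdisc] at hx
    exact ⟨_, by rw [hx, sq]⟩
  · rintro ⟨s, hs⟩
    obtain ⟨x, hx⟩ := exists_quadratic_eq_zero (one_ne_zero (α := K)) (b := -g.trace) (c := g.det) ⟨s, by rw [hdisc, hs]⟩
    exact ⟨x, (hform x).2 hx⟩

omit [Valued K ℤᵐ⁰] in
/-- **`χ_{φg}` has no root when `χ_g` has none**: their discriminants differ by the non-zero square `((a²−b²)∕det D)²` (★ FILE α `disc_moebius_fin_two`).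
[cite: Kottwitz1986, §3] [cite: Rogawski1990, §4.9 Prop. 4.9.1 (b) p. 55] -/
theorem not_exists_isRoot_charpoly_moebius [NeZero (2 : K)] (g : Matrix (Fin 2) (Fin 2) K) (a b : K) (hD : (b • g + a • (1 : Matrix (Fin 2) (Fin 2) K)).det ≠ 0)
    (hab : a ^ 2 - b ^ 2 ≠ 0) (hirr : ¬ ∃ x : K, g.charpoly.IsRoot x) :
    ¬ ∃ x : K, ((a • g + b • (1 : Matrix (Fin 2) (Fin 2) K)) * (b • g + a • (1 : Matrix (Fin 2) (Fin 2) K))⁻¹).charpoly.IsRoot x := by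
  rw [exists_isRoot_charpoly_iff_isSquare_disc] at hirr ⊢
  rintro ⟨s, hs⟩
  have key := disc_moebius_fin_two g a b hD
  refine hirr ⟨s * (b • g + a • (1 : Matrix (Fin 2) (Fin 2) K)).det / (a ^ 2 - b ^ 2), ?_⟩
  field_simp
  linear_combination (b • g + a • (1 : Matrix (Fin 2) (Fin 2) K)).det ^ 2 * hs - key

omit [Valued K ℤᵐ⁰] in
/-- **`χ_g · (X − u)` is separable** when `disc χ_g ≠ 0` and `χ_g(u) ≠ 0` — the `G`-regularity of a type-(2) pair `(g, u)` read on `tr`, `det`, `χ_g(u)`.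
[cite: Rogawski1990, §4.3 p. 42] -/
theorem separable_charpoly_mul_X_sub_C (g : Matrix (Fin 2) (Fin 2) K) (u : K) (hdisc : g.trace ^ 2 - 4 * g.det ≠ 0) (hu : g.charpoly.eval u ≠ 0) :
    (g.charpoly * (X - C u)).Separable := by
  refine (Literature.NumberTheory.Rogawski1990.charpoly_separable_of_trace_sq_sub_four_mul_det_ne_zero g hdisc).mul Polynomial.separable_X_sub_C ?_
  refine ((Polynomial.irreducible_X_sub_C u).coprime_iff_not_dvd.2 fun h => hu ?_).symm
  exact (Polynomial.dvd_iff_isRoot.1 h)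

/-! ## §5 Integrality of the shifted pair -/

/-- **`φg = N₊N₋⁻¹` is integral** when `X₂` is and `det N₋` is a unit. [cite: Kottwitz1986, §3] -/
theorem forall_valued_moebius_le_one {m : Type*} [Fintype m] [DecidableEq m] {c : K} (hcle : Valued.v c ≤ 1) {X : Matrix m m K} (hX : ∀ i j, Valued.v (X i j) ≤ 1)
    (hm : Valued.v (((2 : K) • (1 : Matrix m m K) + (c - 1) • X).det) = 1) :
    ∀ i j, Valued.v ((((2 : K) • (1 : Matrix m m K) + (c + 1) • X) * ((2 : K) • (1 : Matrix m m K) + (c - 1) • X)⁻¹) i j) ≤ 1 := by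
  set O : Subring K := (Valued.v : Valuation K ℤᵐ⁰).integer with hOdef
  have hO : ∀ {x : K}, x ∈ O ↔ Valued.v x ≤ 1 := fun {x} => Valuation.mem_integer_iff _ _
  have hX' : ∀ i j, X i j ∈ O := fun i j => hO.2 (hX i j)
  have hc' : c ∈ O := hO.2 hcle
  have h2 : (2 : K) ∈ O := by simp
  have hm' : ∃ d ∈ O, d * ((2 : K) • (1 : Matrix m m K) + (c - 1) • X).det = 1 := by
    have hne : ((2 : K) • (1 : Matrix m m K) + (c - 1) • X).det ≠ 0 := fun h => by rw [h, map_zero] at hm; exact zero_ne_one hm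
    exact ⟨_, hO.2 (by rw [map_inv₀, hm, inv_one]), inv_mul_cancel₀ hne⟩
  intro i j
  exact hO.1 (forall_mem_mul O (forall_mem_smul_one_add_smul O hX' h2 (O.add_mem hc' O.one_mem))
    (forall_mem_inv O (forall_mem_smul_one_add_smul O hX' h2 (O.sub_mem hc' O.one_mem)) hm') i j)

/-- **`φu` is a unit** (`|(c+1)u + (c−1)| = |(c−1)u + (c+1)| = exp(−1)`). [cite: Kottwitz1986, §3] -/
theorem valued_moebius_one_eq_one {c u : K} (hm : Valued.v ((c - 1) * u + (c + 1)) = WithZero.exp (-1 : ℤ)) (hp : Valued.v ((c + 1) * u + (c - 1)) = WithZero.exp (-1 : ℤ)) :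
    Valued.v (((c + 1) * u + (c - 1)) / ((c - 1) * u + (c + 1))) = 1 := by
  rw [map_div₀, hm, hp, div_self WithZero.exp_ne_zero]

end Literature.NumberTheory.Automorphic.MoebiusShift
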